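import Literature.NumberTheory.EllipticCurves.PAdicMeasureTransform
import Literature.NumberTheory.EllipticCurves.IwasawaAlgebraUnitTwist
import Mathlib.Analysis.Normed.Group.Tannery
import HarnessLib

/-!
# The `ψ`-twisted Mellin transform of a bounded distribution IS the unit twist `T ↦ ε(1+T) − 1` of its Mellin
# transform (`ψ(γ) = ε ∈ 1 + pℤ_p`) — measure-generic (proofs only; 0 def, 0 fact)

Topic `NumberTheory/EllipticCurves`; namespace `Literature.NumberTheory.EllipticCurves`. THEOREMS ONLY: no definition, no
named fact, no `instance`, no notation, no `sorry`. Companion of `PAdicMeasureTransform` (the transform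
`L_μ(T) = ∫_{ℤ_p^×} (1+T)^{ℓ(x)} dμ` of a bounded distribution `μ : (n : ℕ) → ℤ/pⁿ → ℚ_p`, coefficients
`[T^k]L_μ = lim_n RS k n`, `RS k n = ∑_η ∑_{s mod pⁿ} μ(ηγˢ + p^{n+e₀}ℤ_p)·C(s,k)`) and of `IwasawaAlgebraUnitTwist`
(`PadicIntSeries.unitTwist Q ε`: the substitution `T ↦ ε(1+T) − 1` on `ℤ_p⟦T⟧`, `[T^k] = ∑_{j ≥ k} [T^j]Q·C(j,k)(ε−1)^{j−k}ε^k`,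
a ring automorphism for `ε ∈ 1 + pℤ_p` — Li–Tian–Yan–Zhu's `ι_c : γ ↦ c(γ)γ`).

**The point.** Mazur–Tate–Teitelbaum 1986 §I.13 / Greenberg LNM 1716 §1: the `p`-adic `L`-function is a function on the
characters `ω^i · ψ · (1+T)^{ℓ(x)}` of `ℤ_p^× = Δ × Γ`; twisting the transform by a finite-order character `ψ` of `Γ`,
`ψ(γ) = ε` — Riemann sums `TRS k n = ∑_η ∑_s εˢ μ(ηγˢ + p^{n+e₀}ℤ_p)·C(s,k)` (the shape of the tree's
`padicLMinusBranchMultTwistRiemannSum`, file `PAdicLFunctionMinusMultGammaTwist`) — is, as a function of `T`, the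
substitution `T ↦ ε(1+T) − 1`, which is NOT a formal substitution (`ε − 1` is only topologically nilpotent). This file
proves the bridge for an ABSTRACT bounded distribution (hypotheses `hRS` / `hTRS` on two functions `RS TRS : ℕ → ℕ → ℚ_p`,
as in `PAdicMeasureTransform`):

* §1 `pow_mul_choose_eq_sum_choose_mul` — the finite identity `εˢ·C(s,k) = ∑_{j ≤ s} C(s,j)·C(j,k)(ε−1)^{j−k}ε^k`
  (coefficient of `T^k` in `εˢ(1+T)ˢ = (1 + ((ε−1) + εT))ˢ`).
* §2 `twistedRiemannSum_eq_sum` — at every finite level `TRS k n = ∑_{j < pⁿ} C(j,k)(ε−1)^{j−k}ε^k · RS j n`;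
  **`tendsto_twistedRiemannSum_of_distribution`** — for a bounded distribution and `‖ε − 1‖ < 1` the twisted Riemann sums
  CONVERGE, to `∑'_j C(j,k)(ε−1)^{j−k}ε^k · [T^j]L_μ` (Tannery's theorem: `‖RS j n‖ ≤ C`, weights `≤ ‖ε−1‖^{j−k}`);
  `limUnder_twistedRiemannSum_eq_tsum`, `norm_limUnder_twistedRiemannSum_le` (`≤ C`).
* §3 `coe_coeff_unitTwist_eq_of_coeff_eq` / **`iwasawaToPowerSeries_unitTwist_eq_of_eq`** — for every integral multiple
  `Q ∈ Λ` of the transform (`Q^ℚ = C c · L_μ`), `(unitTwist Q ε)^ℚ = C c · L_μ^ψ`, `L_μ^ψ = mk (lim TRS ·)`.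

The specialisation to the one-term minus measure at `p ∣ N` (`padicLFunctionMinusBranchMultTwist = Tw_ε padicLFunctionMinusBranchMult`
on integral multiples) is the sibling `PAdicLFunctionMinusMultGammaTwistUnitTwistProofs`. Motivation (cell `bsd-2adic`, seat
`k4-w3` GEN 2, crux stmt-BirchSwinnertonDyer-22618 C4″, reading R15): at `p = 2`, `ε = −1` (`ψ = χ₂`, the character of
`ℚ(√2) = ℚ₁ ⊂ ℚ_∞`) this is the transport `Tw : (1+T) ↦ −(1+T)` between the `(−1)`- and `(−2)`-split-twist blocks of an
additive `2`. NOT here: functional equations (`PAdicMeasureTransformWeightTwist`), anything Selmer-side.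

## References
* B. Mazur, J. Tate, J. Teitelbaum, *On `p`-adic analogues of the conjectures of Birch and Swinnerton-Dyer*, Invent. Math.
  84 (1986) 1–48: §I.11 (measures), §I.12 (`Λ ⊗ ℚ`), §I.13 (characters of `ℤ_p^×`, branches, twists). [MazurTateTeitelbaum1986Invent]
* R. Greenberg, *Iwasawa theory for elliptic curves*, LNM 1716 (1999), §1 pp. 67–68 (`x = ω(x)⟨x⟩`, twists by characters
  of `Γ`), §4 p. 107 (`S_{A_s} = S_A ⊗ κ^s`). [GreenbergLNM1716]
* E. de Shalit, *Iwasawa theory of elliptic curves with complex multiplication* (1987), II.4.17 (52) (the twist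
  `T ↦ u(1+T) − 1` as a convergent substitution). [deShalit1987]
* L. C. Washington, *Introduction to cyclotomic fields*, GTM 83, §7.2, §12.2, §13.2. [Washington1997]
-/

noncomputable section

open Filter Topology Finset

namespace Literature.NumberTheory.EllipticCurves

variable {p : ℕ} [Fact p.Prime]

/-! ### §1. The binomial re-expansion `εˢ·C(s,k) = ∑_j C(s,j)·C(j,k)(ε−1)^{j−k}ε^k` -/

section Algebra

variable {R : Type*} [CommRing R]

/-- **`εˢ · C(s,k) = ∑_{j ≤ s} C(s,j) · C(j,k) · (ε−1)^{j−k} · ε^k`** in any commutative ring: the coefficient of `T^k`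
in `εˢ(1+T)ˢ = (1 + ((ε − 1) + εT))ˢ` expanded twice by the binomial theorem; directly: `C(s,j)C(j,k) =
C(s,k)C(s−k,j−k)` and `∑_m C(s−k,m)(ε−1)^m = ε^{s−k}`. This is the finite-level shadow of the substitution
`T ↦ ε(1+T) − 1` on `∫ (1+T)^{ℓ(x)} dμ`. [cite: deShalit1987, II.4.17 (52) (p. 77)] -/
theorem pow_mul_choose_eq_sum_choose_mul (ε : R) (s k : ℕ) :
    ε ^ s * (s.choose k : R) =
      ∑ j ∈ range (s + 1), (s.choose j : R) * ((j.choose k : R) * (ε - 1) ^ (j - k) * ε ^ k) := by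
  rcases lt_or_ge s k with hsk | hks
  · -- both sides vanish
    rw [Nat.choose_eq_zero_of_lt hsk, Nat.cast_zero, mul_zero]
    refine (sum_eq_zero fun j hj ↦ ?_).symm
    rw [mem_range] at hj
    rw [Nat.choose_eq_zero_of_lt (by omega : j < k), Nat.cast_zero, zero_mul, zero_mul, mul_zero]
  · -- `k ≤ s`: drop the terms `j < k`, reindex `j = k + m`, use `C(s,k+m)C(k+m,k) = C(s,k)C(s−k,m)` and the binomial theorem
    have hsplit : ∑ j ∈ range (s + 1), (s.choose j : R) * ((j.choose k : R) * (ε - 1) ^ (j - k) * ε ^ k) =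
        ∑ j ∈ Ico k (s + 1), (s.choose j : R) * ((j.choose k : R) * (ε - 1) ^ (j - k) * ε ^ k) := by
      rw [range_eq_Ico]
      refine (sum_subset (Ico_subset_Ico_left (Nat.zero_le k)) fun j hj hjk ↦ ?_).symm
      have hjk' : j < k := by
        simp only [mem_Ico, Nat.zero_le, true_and, not_and, not_lt] at hj hjk
        by_contra h
        exact absurd (hjk (not_lt.mp h)) (not_le.mpr hj)
      rw [Nat.choose_eq_zero_of_lt hjk', Nat.cast_zero, zero_mul, zero_mul, mul_zero]
    rw [hsplit, sum_Ico_eq_sum_range, show s + 1 - k = s - k + 1 by omega]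
    have hterm : ∀ m ∈ range (s - k + 1),
        (s.choose (k + m) : R) * (((k + m).choose k : R) * (ε - 1) ^ (k + m - k) * ε ^ k) =
          (s.choose k : R) * ε ^ k * ((ε - 1) ^ m * 1 ^ (s - k - m) * ((s - k).choose m : R)) := by
      intro m hm
      rw [mem_range] at hm
      have hkm : k + m ≤ s := by omega
      have h := Nat.choose_mul (n := s) (Nat.le_add_right k m)
      rw [show k + m - k = m by omega] at h ⊢
      have h' : (s.choose (k + m) : R) * ((k + m).choose k : R) = (s.choose k : R) * ((s - k).choose m : R) := by
        rw [← Nat.cast_mul, ← Nat.cast_mul, h]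
      calc (s.choose (k + m) : R) * (((k + m).choose k : R) * (ε - 1) ^ m * ε ^ k)
          = ((s.choose (k + m) : R) * ((k + m).choose k : R)) * ((ε - 1) ^ m * ε ^ k) := by ring
        _ = ((s.choose k : R) * ((s - k).choose m : R)) * ((ε - 1) ^ m * ε ^ k) := by rw [h']
        _ = _ := by rw [one_pow]; ring
    rw [sum_congr rfl hterm, ← mul_sum, ← add_pow, sub_add_cancel]
    rw [mul_assoc, ← pow_add, Nat.add_sub_cancel' hks, mul_comm]

end Algebra

/-! ### §2. Twisted Riemann sums of a bounded distribution: re-expansion and convergence -/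

section RiemannSums

variable {μ : (n : ℕ) → ZMod (p ^ n) → ℚ_[p]} {RS TRS : ℕ → ℕ → ℚ_[p]} {ε : ℚ_[p]}
  (hRS : ∀ k n : ℕ, RS k n =
      ∑ᶠ η : rootsOfUnity (torsionOrder p) ℤ_[p], ∑ s : ZMod (p ^ n),
        μ (n + cyclotomicExponent p)
            (PadicInt.toZModPow (n + cyclotomicExponent p) ((η : ℤ_[p]ˣ) : ℤ_[p]) *
              (cyclotomicGenerator p : ZMod (p ^ (n + cyclotomicExponent p))) ^ s.val) *
          ((s.val.choose k : ℕ) : ℚ_[p]))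
  (hTRS : ∀ k n : ℕ, TRS k n =
      ∑ᶠ η : rootsOfUnity (torsionOrder p) ℤ_[p], ∑ s : ZMod (p ^ n),
        ε ^ s.val *
          μ (n + cyclotomicExponent p)
            (PadicInt.toZModPow (n + cyclotomicExponent p) ((η : ℤ_[p]ˣ) : ℤ_[p]) *
              (cyclotomicGenerator p : ZMod (p ^ (n + cyclotomicExponent p))) ^ s.val) *
          ((s.val.choose k : ℕ) : ℚ_[p]))

include hRS hTRS

/-- **The `ε`-twisted Riemann sums are the binomial re-expansion of the plain ones, at every finite level**:
`∑_η ∑_{s mod pⁿ} εˢ μ(ηγˢ + p^{n+e₀}) C(s,k) = ∑_{j < pⁿ} C(j,k)(ε−1)^{j−k}ε^k · ∑_η ∑_s μ(ηγˢ + p^{n+e₀}) C(s,j)`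
(`pow_mul_choose_eq_sum_choose_mul`, the terms `j > s` vanishing). [cite: MazurTateTeitelbaum1986Invent, §I.13] -/
theorem twistedRiemannSum_eq_sum (k n : ℕ) :
    TRS k n = ∑ j ∈ range (p ^ n), ((j.choose k : ℚ_[p]) * (ε - 1) ^ (j - k) * ε ^ k) * RS j n := by
  classical
  haveI := neZero_torsionOrder p
  haveI := Fintype.ofFinite (rootsOfUnity (torsionOrder p) ℤ_[p])
  haveI : NeZero (p ^ n) := ⟨pow_ne_zero _ (Fact.out : p.Prime).ne_zero⟩
  -- the weights and the class values
  set c : ℕ → ℚ_[p] := fun j ↦ (j.choose k : ℚ_[p]) * (ε - 1) ^ (j - k) * ε ^ k with hc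
  set w : rootsOfUnity (torsionOrder p) ℤ_[p] → ZMod (p ^ n) → ℚ_[p] := fun η s ↦
    μ (n + cyclotomicExponent p)
      (PadicInt.toZModPow (n + cyclotomicExponent p) ((η : ℤ_[p]ˣ) : ℤ_[p]) *
        (cyclotomicGenerator p : ZMod (p ^ (n + cyclotomicExponent p))) ^ s.val) with hw
  have hR : ∀ j, RS j n = ∑ η : rootsOfUnity (torsionOrder p) ℤ_[p], ∑ s : ZMod (p ^ n),
      w η s * ((s.val.choose j : ℕ) : ℚ_[p]) := fun j ↦ by
    rw [hRS, finsum_eq_sum_of_fintype]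
  have hT : TRS k n = ∑ η : rootsOfUnity (torsionOrder p) ℤ_[p], ∑ s : ZMod (p ^ n),
      ε ^ s.val * w η s * ((s.val.choose k : ℕ) : ℚ_[p]) := by
    rw [hTRS, finsum_eq_sum_of_fintype]
  -- one class `η γˢ`: `εˢ C(s,k) = ∑_{j < pⁿ} C(s,j) c_j`
  have hclass : ∀ s : ZMod (p ^ n), ε ^ s.val * (s.val.choose k : ℚ_[p]) =
      ∑ j ∈ range (p ^ n), (s.val.choose j : ℚ_[p]) * c j := by
    intro s
    rw [pow_mul_choose_eq_sum_choose_mul ε s.val k]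
    refine sum_subset (range_subset_range.mpr (Nat.succ_le_of_lt (ZMod.val_lt s))) fun j _ hj ↦ ?_
    rw [mem_range, not_lt] at hj
    rw [Nat.choose_eq_zero_of_lt (by omega : s.val < j), Nat.cast_zero, zero_mul]
  calc TRS k n = ∑ η : rootsOfUnity (torsionOrder p) ℤ_[p], ∑ s : ZMod (p ^ n),
        ∑ j ∈ range (p ^ n), c j * (w η s * ((s.val.choose j : ℕ) : ℚ_[p])) := by
        rw [hT]
        refine sum_congr rfl fun η _ ↦ sum_congr rfl fun s _ ↦ ?_
        calc ε ^ s.val * w η s * ((s.val.choose k : ℕ) : ℚ_[p])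
            = (ε ^ s.val * (s.val.choose k : ℚ_[p])) * w η s := by ring
          _ = (∑ j ∈ range (p ^ n), (s.val.choose j : ℚ_[p]) * c j) * w η s := by rw [hclass s]
          _ = _ := by
              rw [sum_mul]
              refine sum_congr rfl fun j _ ↦ ?_
              ring
    _ = ∑ j ∈ range (p ^ n), c j * ∑ η : rootsOfUnity (torsionOrder p) ℤ_[p], ∑ s : ZMod (p ^ n),
        w η s * ((s.val.choose j : ℕ) : ℚ_[p]) := by
        symm
        simp_rw [mul_sum]
        rw [sum_comm]
        refine sum_congr rfl fun η _ ↦ ?_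
        rw [sum_comm]
    _ = ∑ j ∈ range (p ^ n), c j * RS j n := by
        refine sum_congr rfl fun j _ ↦ ?_
        rw [hR j]

omit hTRS in
/-- The plain Riemann sums as a `tsum` cut-off: `∑_{j < pⁿ} c_j · RS j n = ∑'_j c_j · RS j n` (`RS j n = 0` for `j ≥ pⁿ`,
`riemannSum_eq_zero_of_le`). [cite: MazurTateTeitelbaum1986Invent, §I.13] -/
theorem sum_range_mul_riemannSum_eq_tsum (c : ℕ → ℚ_[p]) (n : ℕ) :
    ∑ j ∈ range (p ^ n), c j * RS j n = ∑' j, c j * RS j n := by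
  refine (tsum_eq_sum fun j hj ↦ ?_).symm
  rw [mem_range, not_lt] at hj
  rw [riemannSum_eq_zero_of_le hRS hj, mul_zero]

omit hRS hTRS in
/-- The weights `C(j,k)(ε−1)^{j−k}ε^k` are dominated by `‖ε − 1‖^{j−k}` when `‖ε − 1‖ < 1` (then `‖ε‖ ≤ 1`).
[cite: deShalit1987, II.4.17 (52) (p. 77)] -/
theorem norm_twistWeight_le (hε : ‖ε - 1‖ < 1) (j k : ℕ) :
    ‖(j.choose k : ℚ_[p]) * (ε - 1) ^ (j - k) * ε ^ k‖ ≤ ‖ε - 1‖ ^ (j - k) := by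
  have hε1 : ‖ε‖ ≤ 1 := by
    have h : ε = (ε - 1) + 1 := by ring
    rw [h]
    refine (IsUltrametricDist.norm_add_le_max _ _).trans (max_le hε.le ?_)
    rw [norm_one]
  have hchoose : ‖(j.choose k : ℚ_[p])‖ ≤ 1 := by
    have h := Padic.norm_int_le_one (p := p) ((j.choose k : ℕ) : ℤ)
    rwa [Int.cast_natCast] at h
  rw [norm_mul, norm_mul, norm_pow, norm_pow]
  calc ‖(j.choose k : ℚ_[p])‖ * ‖ε - 1‖ ^ (j - k) * ‖ε‖ ^ k ≤ 1 * ‖ε - 1‖ ^ (j - k) * 1 := by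
        gcongr
        exact pow_le_one₀ (norm_nonneg _) hε1
    _ = ‖ε - 1‖ ^ (j - k) := by ring

omit hRS hTRS in
/-- `∑_j C·‖ε − 1‖^{j−k}` converges for `‖ε − 1‖ < 1` (a shifted geometric series). [cite: deShalit1987, II.4.17 (52) (p. 77)] -/
theorem summable_const_mul_norm_sub_one_pow (hε : ‖ε - 1‖ < 1) (C : ℝ) (k : ℕ) :
    Summable fun j : ℕ ↦ C * ‖ε - 1‖ ^ (j - k) := by
  have hg : Summable fun j : ℕ ↦ ‖ε - 1‖ ^ (j - k) := by
    have h0 := summable_geometric_of_lt_one (norm_nonneg (ε - 1)) hε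
    rw [← summable_nat_add_iff k]
    simpa using h0
  exact hg.mul_left C

/-- **Convergence of the `ε`-twisted Riemann sums of a bounded distribution, and their limit**: for `‖ε − 1‖ < 1`,
`TRS k n ⟶ ∑'_j C(j,k)(ε−1)^{j−k}ε^k · lim_n RS j n` — i.e. `[T^k] ∫ ψ(⟨x⟩)(1+T)^{ℓ(x)} dμ` is the `k`-th coefficient of
the unit twist `T ↦ ε(1+T) − 1` of `∫ (1+T)^{ℓ(x)} dμ`. Tannery's theorem on the re-expansion `twistedRiemannSum_eq_sum`:
domination `‖c_j RS j n‖ ≤ C‖ε−1‖^{j−k}` (`norm_riemannSum_le`, `norm_twistWeight_le`), termwise convergence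
`tendsto_riemannSum_of_distribution`. [cite: MazurTateTeitelbaum1986Invent, §I.13] [cite: GreenbergLNM1716, §1 (pp. 67–68)] -/
theorem tendsto_twistedRiemannSum_of_distribution
    (hdist : ∀ (n : ℕ) (a : ZMod (p ^ n)),
      ∑ b ∈ Finset.univ.filter (fun b : ZMod (p ^ (n + 1)) ↦
        ZMod.castHom (pow_dvd_pow p n.le_succ) (ZMod (p ^ n)) b = a), μ (n + 1) b = μ n a)
    {C : ℝ} (hC : ∀ (n : ℕ) (a : ZMod (p ^ n)), ‖μ n a‖ ≤ C) (hε : ‖ε - 1‖ < 1) (k : ℕ) :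
    Tendsto (fun n ↦ TRS k n) atTop
      (𝓝 (∑' j : ℕ, ((j.choose k : ℚ_[p]) * (ε - 1) ^ (j - k) * ε ^ k) * limUnder atTop fun n ↦ RS j n)) := by
  have hC0 : 0 ≤ C := (norm_nonneg _).trans (hC 0 0)
  have heq : (fun n ↦ TRS k n) =
      fun n ↦ ∑' j : ℕ, ((j.choose k : ℚ_[p]) * (ε - 1) ^ (j - k) * ε ^ k) * RS j n := by
    funext n
    rw [twistedRiemannSum_eq_sum hRS hTRS k n,
      sum_range_mul_riemannSum_eq_tsum hRS (fun j ↦ (j.choose k : ℚ_[p]) * (ε - 1) ^ (j - k) * ε ^ k) n]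
  rw [heq]
  refine tendsto_tsum_of_dominated_convergence (summable_const_mul_norm_sub_one_pow hε C k)
    (fun j ↦ ?_) (Eventually.of_forall fun n j ↦ ?_)
  · exact tendsto_const_nhds.mul (tendsto_riemannSum_of_distribution hRS hdist hC j)
  · rw [norm_mul]
    calc _ ≤ ‖ε - 1‖ ^ (j - k) * C :=
          mul_le_mul (norm_twistWeight_le hε j k) (norm_riemannSum_le hRS hC j n) (norm_nonneg _)
            (pow_nonneg (norm_nonneg _) _)
      _ = C * ‖ε - 1‖ ^ (j - k) := mul_comm _ _

/-- The limit of the twisted Riemann sums, as an equation for `limUnder`. [cite: MazurTateTeitelbaum1986Invent, §I.13] -/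
theorem limUnder_twistedRiemannSum_eq_tsum
    (hdist : ∀ (n : ℕ) (a : ZMod (p ^ n)),
      ∑ b ∈ Finset.univ.filter (fun b : ZMod (p ^ (n + 1)) ↦
        ZMod.castHom (pow_dvd_pow p n.le_succ) (ZMod (p ^ n)) b = a), μ (n + 1) b = μ n a)
    {C : ℝ} (hC : ∀ (n : ℕ) (a : ZMod (p ^ n)), ‖μ n a‖ ≤ C) (hε : ‖ε - 1‖ < 1) (k : ℕ) :
    (limUnder atTop fun n ↦ TRS k n) =
      ∑' j : ℕ, ((j.choose k : ℚ_[p]) * (ε - 1) ^ (j - k) * ε ^ k) * limUnder atTop fun n ↦ RS j n :=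
  (tendsto_twistedRiemannSum_of_distribution hRS hTRS hdist hC hε k).limUnder_eq

/-- **The twisted coefficients are bounded by the bound of `μ`**: `‖lim_n TRS k n‖ ≤ C` (each twisted Riemann sum has norm
`≤ C` — summands `εˢ μ(…) C(s,k)` with `‖ε‖ ≤ 1` — and closed balls are closed). [cite: MazurTateTeitelbaum1986Invent, §I.12] -/
theorem norm_limUnder_twistedRiemannSum_le
    (hdist : ∀ (n : ℕ) (a : ZMod (p ^ n)),
      ∑ b ∈ Finset.univ.filter (fun b : ZMod (p ^ (n + 1)) ↦
        ZMod.castHom (pow_dvd_pow p n.le_succ) (ZMod (p ^ n)) b = a), μ (n + 1) b = μ n a)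
    {C : ℝ} (hC : ∀ (n : ℕ) (a : ZMod (p ^ n)), ‖μ n a‖ ≤ C) (hε : ‖ε - 1‖ < 1) (k : ℕ) :
    ‖limUnder atTop fun n ↦ TRS k n‖ ≤ C := by
  classical
  haveI := neZero_torsionOrder p
  haveI := Fintype.ofFinite (rootsOfUnity (torsionOrder p) ℤ_[p])
  have hC0 : 0 ≤ C := (norm_nonneg _).trans (hC 0 0)
  have hε1 : ‖ε‖ ≤ 1 := by
    have h : ε = (ε - 1) + 1 := by ring
    rw [h]
    refine (IsUltrametricDist.norm_add_le_max _ _).trans (max_le hε.le ?_)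
    rw [norm_one]
  have hbound : ∀ n, ‖TRS k n‖ ≤ C := by
    intro n
    rw [hTRS, finsum_eq_sum_of_fintype]
    refine IsUltrametricDist.norm_sum_le_of_forall_le_of_nonneg hC0 fun η _ ↦ ?_
    refine IsUltrametricDist.norm_sum_le_of_forall_le_of_nonneg hC0 fun s _ ↦ ?_
    have h := Padic.norm_int_le_one (p := p) ((s.val.choose k : ℕ) : ℤ)
    rw [Int.cast_natCast] at h
    rw [norm_mul, norm_mul, norm_pow]
    calc ‖ε‖ ^ s.val * ‖_‖ * _ ≤ 1 * C * 1 := by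
          gcongr
          · exact pow_le_one₀ (norm_nonneg _) hε1
          · exact hC _ _
      _ = C := by ring
  have ht := tendsto_twistedRiemannSum_of_distribution hRS hTRS hdist hC hε k
  rw [ht.limUnder_eq]
  exact le_of_tendsto ht.norm (Eventually.of_forall hbound)

end RiemannSums

/-! ### §3. The currency of integral multiples: `Q^ℚ = C c · L_μ ⟹ (unitTwist Q ε)^ℚ = C c · L_μ^ψ` -/

section UnitTwist

variable {μ : (n : ℕ) → ZMod (p ^ n) → ℚ_[p]} {RS TRS : ℕ → ℕ → ℚ_[p]} {ε : ℤ_[p]}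
  (hRS : ∀ k n : ℕ, RS k n =
      ∑ᶠ η : rootsOfUnity (torsionOrder p) ℤ_[p], ∑ s : ZMod (p ^ n),
        μ (n + cyclotomicExponent p)
            (PadicInt.toZModPow (n + cyclotomicExponent p) ((η : ℤ_[p]ˣ) : ℤ_[p]) *
              (cyclotomicGenerator p : ZMod (p ^ (n + cyclotomicExponent p))) ^ s.val) *
          ((s.val.choose k : ℕ) : ℚ_[p]))
  (hTRS : ∀ k n : ℕ, TRS k n =
      ∑ᶠ η : rootsOfUnity (torsionOrder p) ℤ_[p], ∑ s : ZMod (p ^ n),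
        (ε : ℚ_[p]) ^ s.val *
          μ (n + cyclotomicExponent p)
            (PadicInt.toZModPow (n + cyclotomicExponent p) ((η : ℤ_[p]ˣ) : ℤ_[p]) *
              (cyclotomicGenerator p : ZMod (p ^ (n + cyclotomicExponent p))) ^ s.val) *
          ((s.val.choose k : ℕ) : ℚ_[p]))

include hRS hTRS

omit hRS hTRS in
/-- `‖(ε : ℚ_p) − 1‖ = ‖ε − 1‖` (the inclusion `ℤ_p ↪ ℚ_p` is isometric). [folklore] -/
private theorem norm_coe_sub_one_eq (ε : ℤ_[p]) : ‖(ε : ℚ_[p]) - 1‖ = ‖ε - 1‖ := by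
  rw [← PadicInt.coe_one, ← PadicInt.coe_sub, PadicInt.padic_norm_e_of_padicInt]

/-- **Coefficients of the unit twist of an integral multiple of the transform**: if `[T^j]Q = c · lim_n RS j n` in `ℚ_p`
for every `j` (`Q ∈ ℤ_p⟦T⟧`, `c ∈ ℚ_p`), then `[T^k](unitTwist Q ε) = c · lim_n TRS k n` for `ε ∈ 1 + pℤ_p` — the twist
coefficient `∑'_j [T^j]Q·C(j,k)(ε−1)^{j−k}ε^k` (`PadicIntSeries.coeff_unitTwist`) read in `ℚ_p` against
`limUnder_twistedRiemannSum_eq_tsum`. [cite: deShalit1987, II.4.17 (52) (p. 77)] [cite: MazurTateTeitelbaum1986Invent, §I.13] -/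
theorem coe_coeff_unitTwist_eq_of_coeff_eq
    (hdist : ∀ (n : ℕ) (a : ZMod (p ^ n)),
      ∑ b ∈ Finset.univ.filter (fun b : ZMod (p ^ (n + 1)) ↦
        ZMod.castHom (pow_dvd_pow p n.le_succ) (ZMod (p ^ n)) b = a), μ (n + 1) b = μ n a)
    {C : ℝ} (hC : ∀ (n : ℕ) (a : ZMod (p ^ n)), ‖μ n a‖ ≤ C) (hε : ‖ε - 1‖ < 1)
    {Q : PowerSeries ℤ_[p]} {c : ℚ_[p]}
    (hQ : ∀ j : ℕ, ((PowerSeries.coeff j Q : ℤ_[p]) : ℚ_[p]) = c * limUnder atTop fun n ↦ RS j n) (k : ℕ) :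
    ((PowerSeries.coeff k (PadicIntSeries.unitTwist Q ε) : ℤ_[p]) : ℚ_[p]) = c * limUnder atTop fun n ↦ TRS k n := by
  have hε' : ‖(ε : ℚ_[p]) - 1‖ < 1 := by rwa [norm_coe_sub_one_eq]
  rw [PadicIntSeries.coeff_unitTwist, limUnder_twistedRiemannSum_eq_tsum hRS hTRS hdist hC hε' k, ← tsum_mul_left]
  -- push the continuous additive inclusion `ℤ_p → ℚ_p` through the `tsum`
  set φ : ℤ_[p] →+ ℚ_[p] :=
    { toFun := fun x => (x : ℚ_[p])
      map_zero' := by simp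
      map_add' := fun x y => by simp } with hφ
  have hφc : Continuous φ := continuous_subtype_val
  have hsum := ((PadicIntSeries.summable_twistTerm Q hε k).hasSum.map φ hφc).tsum_eq
  change φ (∑' j : ℕ, PadicIntSeries.twistTerm Q ε k j) = _
  rw [← hsum]
  refine tsum_congr fun j ↦ ?_
  simp only [Function.comp_apply, hφ, AddMonoidHom.coe_mk, ZeroHom.coe_mk, PadicIntSeries.twistTerm]
  push_cast
  rw [hQ j]
  ring

/-- **`Q^ℚ = C c · L_μ ⟹ (unitTwist Q ε)^ℚ = C c · L_μ^ψ`** (`ψ(γ) = ε ∈ 1 + pℤ_p`), for the transform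
`L_μ = mk (lim RS ·)` and the twisted transform `L_μ^ψ = mk (lim TRS ·)` of a bounded distribution, in the tree's currency
`iwasawaToPowerSeries p : Λ → ℚ_p⟦T⟧`: every integral multiple of the Mellin transform twists, under the `Λ`-automorphism
`(1+T) ↦ ε(1+T)`, to the same multiple of the `ψ`-twisted transform. [cite: MazurTateTeitelbaum1986Invent, §I.13]
[cite: GreenbergLNM1716, §1 (pp. 67–68)] -/
theorem iwasawaToPowerSeries_unitTwist_eq_of_eq
    (hdist : ∀ (n : ℕ) (a : ZMod (p ^ n)),
      ∑ b ∈ Finset.univ.filter (fun b : ZMod (p ^ (n + 1)) ↦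
        ZMod.castHom (pow_dvd_pow p n.le_succ) (ZMod (p ^ n)) b = a), μ (n + 1) b = μ n a)
    {C : ℝ} (hC : ∀ (n : ℕ) (a : ZMod (p ^ n)), ‖μ n a‖ ≤ C) (hε : ‖ε - 1‖ < 1)
    {Q : IwasawaAlgebra p} {c : ℚ_[p]}
    (hQ : iwasawaToPowerSeries p Q = PowerSeries.C c * PowerSeries.mk fun j ↦ limUnder atTop fun n ↦ RS j n) :
    iwasawaToPowerSeries p (PadicIntSeries.unitTwist Q ε) =
      PowerSeries.C c * PowerSeries.mk fun k ↦ limUnder atTop fun n ↦ TRS k n := by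
  have hQ' : ∀ j : ℕ, ((PowerSeries.coeff j Q : ℤ_[p]) : ℚ_[p]) = c * limUnder atTop fun n ↦ RS j n := by
    intro j
    have h := congrArg (PowerSeries.coeff j) hQ
    rw [PowerSeries.coeff_C_mul, PowerSeries.coeff_mk] at h
    rw [← h]
    rfl
  ext k
  rw [PowerSeries.coeff_C_mul, PowerSeries.coeff_mk, ← coe_coeff_unitTwist_eq_of_coeff_eq hRS hTRS hdist hC hε hQ' k]
  rfl

end UnitTwist

end Literature.NumberTheory.EllipticCurves

end
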